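/-
Copyright (c) 2026 the pub-hodgecm-mathlib formalisation cell (harness21).  Prover seat hodgecm-mathlib-K2Liu-p01 (g8), Track B «K2-LIT»,
#184♮ = hLiu418 = `stmt-HodgeConjecture-24832`; #42S organ S1 ROAD W, F7 ∕ F8 assembly (RULINGS «M-158a» (2), «M-158b»; LEAD BATCH #8 (4)); glue point (g1) of my
12:3xZ ASSEMBLY RECIPE: ★ F3f's proof-carrying profile sum ↔ the TOTAL-function sums of ★ (T4-core) ∕ ★ (T4-core-split).
-/
import Mathlib.Algebra.BigOperators.Group.Finset.Basic
import Mathlib.GroupTheory.QuotientGroup.Defs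
import Mathlib.Data.Complex.Basic
import HarnessLib

/-!
# Crux `HLiu418`, #42S-S1 ROAD W, glue (g1): PROOF-CARRYING PROFILE SUMS = SUMS OF THE `dite`-EXTENDED TOTAL PROFILE
# `Σ_{r ∈ S₁⧸S₀} f(r̃, h_r̃) = Σ_{r ∈ S₁⧸S₀} P(r̃)`, `P t := if h : Q t then f t h else 0`

Cell `hodgecm-mathlib`, crux item hLiu418 = `stmt-HodgeConjecture-24832` (helper lane `--supports … --as helper`, count-neutral).  THEOREMS ONLY (no `def`, no instance,
no notation, no named-fact hypothesis, no `sorry`).  GENERIC.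

WHY.  ★ F3f `K2LiuLocalSWCoordinateQuotient.sum_quotient_eq_sum_skewQuotient` rewrites the socket's `hsum` as `Σ_{r : S₁ ⧸ S₀.addSubgroupOf S₁} g (nElem r.out.1 (proof that r.out is skew))`
— a sum of a function `f : ∀ t, Q t → ℂ` needing the proof `Q t` (skewness); ★ (T4-core) `K2LiuParityWitnessProfileSum.sum_profile_ne_zero` and ★ (T4-core-split) take TOTAL profiles
`P : M → ℂ`.  The bridge is the `dite`-extension `P t := if h : Q t then f t h else 0` (all `t ∈ S₁` satisfy `Q`): the two sums agree termwise (`dif_pos`, proof irrelevance), and the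
invariance ∕ support hypotheses transfer.
* **`sum_quotient_dite_eq`** — the sums agree;   * `dite_apply_of` — `P t = f t h` on `Q t`;   * **`dite_invariant_of`**, **`dite_support_of`** — `hinv`∕`hsupp` of ★ (T4-core) from their
  proof-carrying versions (`Q` closed under `+` with `S₀ ⊆ Q`).
[BernsteinZelevinsky1976, §1.5] [KudlaRallis1994, §2].
HONEST LABEL.  Count-neutral helper; `HC_CM` is proved only modulo the 7 printed citations (2 remaining named inputs: hLiu418 = `stmt-HodgeConjecture-24832`,
h413 = `stmt-HodgeConjecture-24833`) until rung 0 closes.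

## References
* [BernsteinZelevinsky1976] I. N. Bernstein, A. V. Zelevinsky, Russian Math. Surveys 31 (1976), §1.5.
* [KudlaRallis1994] S. Kudla, S. Rallis, Ann. of Math. 140 (1994), §2.
-/

set_option autoImplicit false
set_option linter.dupNamespace false -- the mandated namespace repeats `HodgeConjecture.HodgeConjecture`

open Finset

namespace Summit.HodgeConjecture.HodgeConjecture.Cruxes.HLiu418.K2LiuProfileSumSkewBridge

variable {M : Type*} [AddCommGroup M] {A : Type*} [AddCommMonoid A] (Q : M → Prop) [DecidablePred Q] (f : ∀ t, Q t → A)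

omit [AddCommGroup M] in
/-- the `dite`-extension agrees with `f` where `Q` holds. [folklore] -/
theorem dite_apply_of {t : M} (h : Q t) : (fun t => if h : Q t then f t h else 0) t = f t h := by
  simp only [dif_pos h]

omit [AddCommGroup M] in
/-- the `dite`-extension vanishes where `Q` fails. [folklore] -/
theorem dite_apply_of_not {t : M} (h : ¬ Q t) : (fun t => if h : Q t then f t h else 0) t = 0 := by
  simp only [dif_neg h]

/-- **THE SUMS AGREE**: for `S₁` with every element satisfying `Q` and ANY choice of the proofs `hQ`, `Σ_{r : S₁⧸S₀} f(r̃, hQ r̃) = Σ_{r} P(r̃)`, `P` the `dite`-extension.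
[cite: BernsteinZelevinsky1976, §1.5] -/
theorem sum_quotient_dite_eq {S₀ S₁ : AddSubgroup M} [Fintype (S₁ ⧸ S₀.addSubgroupOf S₁)] (hQ : ∀ t ∈ S₁, Q t)
    (hr : ∀ r : S₁ ⧸ S₀.addSubgroupOf S₁, Q ((r.out : S₁) : M)) :
    ∑ r : S₁ ⧸ S₀.addSubgroupOf S₁, f ((r.out : S₁) : M) (hr r) =
      ∑ r : S₁ ⧸ S₀.addSubgroupOf S₁, (fun t => if h : Q t then f t h else 0) ((r.out : S₁) : M) := by
  refine Finset.sum_congr rfl fun r _ => ?_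
  rw [dite_apply_of Q f (hQ _ (r.out).2)]

/-- **INVARIANCE TRANSFERS**: if `Q` is stable under adding elements of `S₀` and `f` is `S₀`-invariant (for any proofs), so is the `dite`-extension on `Q`.
[cite: KudlaRallis1994, §2] -/
theorem dite_invariant_of {S₀ : AddSubgroup M} (hQadd : ∀ t, Q t → ∀ s ∈ S₀, Q (t + s))
    (hf : ∀ t (ht : Q t), ∀ s (hs : s ∈ S₀), f (t + s) (hQadd t ht s hs) = f t ht) {t : M} (ht : Q t) {s : M} (hs : s ∈ S₀) :
    (fun t => if h : Q t then f t h else 0) (t + s) = (fun t => if h : Q t then f t h else 0) t := by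
  rw [dite_apply_of Q f (hQadd t ht s hs), dite_apply_of Q f ht, hf t ht s hs]

omit [AddCommGroup M] in
/-- **SUPPORT TRANSFERS**: if `f` vanishes at `t` (for any proof), the `dite`-extension vanishes at `t`. [cite: KudlaRallis1994, §2] -/
theorem dite_support_of {t : M} (hft : ∀ ht : Q t, f t ht = 0) : (fun t => if h : Q t then f t h else 0) t = 0 := by
  by_cases ht : Q t
  · rw [dite_apply_of Q f ht, hft ht]
  · rw [dite_apply_of_not Q f ht]

omit [AddCommGroup M] in
/-- linear combinations commute with the `dite`-extension: `(f + μ g)^dite = f^dite + μ g^dite` pointwise (`A = ℂ`). [folklore] -/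
theorem dite_add_mul (f g : ∀ t, Q t → ℂ) (μc : ℂ) (t : M) :
    (fun t => if h : Q t then f t h + μc * g t h else 0) t =
      (fun t => if h : Q t then f t h else 0) t + μc * (fun t => if h : Q t then g t h else 0) t := by
  by_cases ht : Q t
  · simp only [dif_pos ht]
  · simp only [dif_neg ht, mul_zero, add_zero]

end Summit.HodgeConjecture.HodgeConjecture.Cruxes.HLiu418.K2LiuProfileSumSkewBridge
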